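import Summits.BirchSwinnertonDyer.Rank1Residual.Additive.GordRankOneKatoCertificateBSD
import Summits.BirchSwinnertonDyer.Rank1Residual.Additive.GordRankOneKatoCertificateThree
import Summits.BirchSwinnertonDyer.Rank1Residual.Additive.KimStructureOfFiveLe
import Summits.BirchSwinnertonDyer.Rank1Residual.Additive.X4RankOneKimResidue
import Summits.BirchSwinnertonDyer.Rank1Residual.Additive.TypeGThreeTowerOfSurj
import HarnessLib

/-!
# X4♯(G-ord) ∧ `r_an = 1`: the Kurihara `∂`-GAP computed by the Kato/Delbourgo side — at `p ≥ 5` a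
# statement modulo PUBLISHED facts + two certificates only (no conjecture), at `p = 3` modulo our
# `∂`-clause conjecture; Kim's Conjecture 1.10 then PREDICTS `∂^{(∞)} = ord_p ∏c` inside it
# (cell `b2b-bsdres`, team n1011, seat p17 gen 2 — sequel of `Additive/X4RankOneKimKatoConsistency.lean`;
# support for rows T-O7K3 (p12) / additive-p2 g19 / T-a2r1c)

HONEST FRAMING (cell `b2b-bsdres`, run/shared/lean/b2b/bsd-rank1-residual/, verbatim in every
file): the goal of the cell is to DELETE the COMBINATION-SHAPED residual classes of the
Birch–Swinnerton-Dyer formula for ALL analytic-rank `≤ 1` elliptic curves over `ℚ` — "full BSD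
formula for every rank `≤ 1` curve in class `C`" assembled STRICTLY from published theorems — so
that the rank-`≤ 1` remainder becomes exactly the CONSTRUCTION-SHAPED classes, which are TYPED
(missing-input `Prop`s), NOT attempted. This is not "finishing BSD". Team n1011: prove what is
provable now; shrink each hard class to its core with data; no claim beyond stated classes;
research routes; census output = EVIDENCE / conjecture items, never a Literature fact; RESIDUAL-MAP
marks change only by signed lines. X4 stays CONSTRUCTION-SHAPED; §I O7 / N10 stay as marked; nothing
here is booked. Theorems only (NO definition, NO Literature fact, NO `_holds`); every published input
(named facts `hE73`, `hKato`), every conjecture and every certificate is an explicit hypothesis;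
`#print axioms` standard.

COVERAGE (stated first, referee 1 proviso): per pair, `W/ℚ` globally minimal, `ClassX4Gord W p` (additive
at `p`, `E[p]` irreducible, potentially good ORDINARY of type (G)), semistability defect `e = 2`,
`ρ̄_{E,p}` onto, analytic rank `1`; §1: `p ≥ 5`; §2: `p = 3`. HYPOTHESES: Kato 17.4 (3) half-eigenspace
divisibility (`hKato` = `Wuthrich2014.kato_halfEigenCharIdeal_dvd_cyclotomicPrime_of_surjective`,
PUBLISHED), `nonempty_modularParametrizationData`, GZK, modularity, the branch-unit certificate
`BranchUnitCertificateAt W p` (EVIDENCE), a (B)-datum `Dh` (`LeadingTermClauses W p Dh`, Delbourgo 2002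
(B)), a modular parametrisation datum `D` with `p ∤ c_D` and the period transfer, ONE non-zero cyclic
prime-level Kurihara number (`∂^{(1)} ≠ ∞`, EVIDENCE); at `p ≥ 5` Kim's clause (6) AS PRINTED (`hE73`,
harvest-2, flag `Kim2026-(6)-cyclic-reading`), at `p = 3` OUR conjecture `X4SharpThreeKimRankOnePartial`.
Kim's Conjecture 1.10 enters ONLY the corollaries that say so.

## What

Kim's clause (6) in rank one says `ord_p #Ш(E) = ∂^{(1)}(δ̃) − ∂^{(∞)}(δ̃)`; the Kato/Delbourgo side
(additive-p2 g19 `ClassX4Gord.schneider_and_padicVal_identity_rankOne_of_katoHalf_of_cert` at `p ≥ 5`,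
p12 `ClassX4Gord.padicVal_identity_three_rankOne_of_katoHalf_of_cert` at `3`) says
`ord_p #Ш(E) + v(Reg_p(E,Dh)) + ord_p ∏c + ord_p ℓ = 1 + 2·ord_p #E(ℚ)_tors`. ELIMINATING `Ш`:

  **`∂^{(1)}(δ̃) − ∂^{(∞)}(δ̃) + v(Reg_p(E,Dh)) + ord_p ∏_ℓ c_ℓ + ord_p ℓ = 1 + 2·ord_p #E(ℚ)_tors`**

— at `p ≥ 5` (§1) modulo published facts and the two certificates ONLY (no conjecture): a
THEOREM-GRADE cross-instrument identity between the Kurihara `∂`-gap (modular symbols, KURX / KUR5) and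
the `p`-adic regulator valuation (height lane); Kim's Conjecture 1.10 at the pair (`∂^{(∞)} = ord_p ∏c`)
then PREDICTS `∂^{(1)}(δ̃) + v(Reg_p) + ord_p ℓ = 1 + 2·ord_p #tors` (`_of_tamagawaDefect`), i.e. a
measured `∂`-gap ≠ `ord_p ∏c`-shifted value REFUTES Conj. 1.10 at the pair and nothing else. At `p = 3`
(§2) the same with our conjecture in place of `hE73` (FILE 6 gave the Conj. 1.10 form; here the gap
form WITHOUT Conj. 1.10). `p ∤ #E(ℚ)_tors` (`E[p]` irreducible) makes the right side `1`.

References: C.-H. Kim, Amer. J. Math. 148 (2026) [Kim2022StructureSelmer] Thm. 1.9 (6), Conj. 1.10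
(PDF p. 8); K. Kato, Astérisque 295 (2004) [Kato2004Asterisque] Thm. 17.4 (3) (p. 273); D. Delbourgo,
JNT 95 (2002) [Delbourgo2002] Thm. (B) (p. 40); cell files cells/n1011/OWNERS.md (T-O7K3, T-a2r1c),
HOME/INBOX.md 2026-08-21 07:33Z (lead R5-25 deal).
-/

noncomputable section

open scoped Classical MatrixGroups ModularForm NumberField

namespace Summit.BirchSwinnertonDyer.Rank1Residual.Additive

open CongruenceSubgroup WeierstrassCurve NumberField Literature.NumberTheory.EllipticCurves
  Literature.NumberTheory.EllipticCurves.ModularForms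
  Literature.NumberTheory.EllipticCurves.Rank1Residual
  Literature.NumberTheory.EllipticCurves.Rank1Residual.Typed
  Literature.NumberTheory.EllipticCurves.Delbourgo2002
  Literature.NumberTheory.GaloisRepresentations Summit.BirchSwinnertonDyer.Rank1Residual.AdditivePotMult
  Summit.BirchSwinnertonDyer.Rank1Residual.X1.MuLambda
  Summit.BirchSwinnertonDyer.Rank1Residual.X1.RankOneParitySqueeze
  IsDedekindDomain

/-! ## §0 The elimination step (cell-agnostic arithmetic) -/

section Elim

variable (W : WeierstrassCurve ℚ) [W.IsGloballyMinimal] (p : ℕ)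

/-- **Elimination of `Ш`**: from the Kurihara identity `ord_p #Ш + ∂^{(∞)} = ∂^{(1)}` (`ℕ∞`, with
`∂^{(1)} ≠ ∞`) and the Kato/Delbourgo identity `ord_p #Ш + R + T + L = B` (`ℤ`), the `∂`-gap identity
`∂^{(1)} = m`, `∂^{(∞)} = d`, `m − d + R + T + L = B`. Arithmetic only. [folklore] -/
theorem kuriharaGap_identity_of_shaOrder_identities {N : ℕ} (f : CuspForm (Gamma0 N) 2)
    (hid : (padicValNat p W.shaOrder : ℕ∞) + kuriharaPartialInfty W p f = kuriharaPartial W p f 1)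
    (hne : kuriharaPartial W p f 1 ≠ ⊤) {R L B T : ℤ}
    (hidK : (padicValNat p W.shaOrder : ℤ) + R + T + L = B) :
    ∃ m d : ℕ, kuriharaPartial W p f 1 = m ∧ kuriharaPartialInfty W p f = d ∧
      (m : ℤ) - d + R + T + L = B := by
  have hinf : kuriharaPartialInfty W p f ≠ ⊤ :=
    kuriharaPartialInfty_ne_top_of_kuriharaPartial_one_ne_top W p f hne
  obtain ⟨d, hd⟩ := ENat.ne_top_iff_exists.mp hinf
  refine ⟨padicValNat p W.shaOrder + d, d, ?_, hd.symm, ?_⟩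
  · rw [← hid, ← hd]
    push_cast
    rfl
  · rw [Nat.cast_add]
    linarith

end Elim

/-! ## §1 `p ≥ 5`: the `∂`-gap by the Kato/Delbourgo side — NO conjecture -/

section FiveLe

variable {W : WeierstrassCurve ℚ} [W.IsElliptic] [W.IsGloballyMinimal] {p : ℕ} [hp : Fact p.Prime]

/-- **X4♯(G-ord) ∩ `I₀*`, `p ≥ 5`, surj(p), `r_an = 1`, branch-unit certificate, (B)-datum, ONE non-zero
prime-level Kurihara number: `∂^{(1)}(δ̃) − ∂^{(∞)}(δ̃) + v(Reg_p(E,Dh)) + ord_p ∏c + ord_p ℓ =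
1 + 2·ord_p #E(ℚ)_tors`** with `ℓ ∣ p²`, `ℓ = 1` off the anomalous rows — modulo the PUBLISHED facts
`hE73` (Kim Thm. 1.8 (6)), `hKato` (Kato 17.4 (3)), GZK, modularity and the two certificates; NO
conjecture. The Serre tower is carried as the explicit binder `htower` (as in every Kim-type file).
A THEOREM-GRADE cross-instrument identity; per pair; nothing booked.
[cite: Kim2022StructureSelmer, Thm. 1.9 (6) (PDF p. 8)] [cite: Kato2004Asterisque, Thm. 17.4 (3) (p. 273)]
[cite: Delbourgo2002, Theorem (B) (p. 40)] -/
theorem ClassX4Gord.kuriharaGap_identity_rankOne_of_kim2026_of_katoHalf_of_cert_of_five_le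
    (hE73 : Kim2026.kuriharaPartial_vanishingOrder_eq_padicValNat_sha_add_partialInfty_of_maninConstant)
    (hKato : Wuthrich2014.kato_halfEigenCharIdeal_dvd_cyclotomicPrime_of_surjective)
    (hmodD : nonempty_modularParametrizationData)
    (hGZK : rank_eq_analyticRank_of_analyticRank_le_one) (hmod : hasEntireLFunction_rat)
    (hX : ClassX4Gord W p) (hp5 : 5 ≤ p) (he : semistabilityIndex W p = 2) (hsurj : Surj W p)
    (htower : ∀ n : ℕ, W.HasSurjectiveModNGaloisRep (p ^ n : ℕ))
    (hr : W.analyticRank = 1) (hcert : BranchUnitCertificateAt W p)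
    {Dh : PAdicHeightData W p} (hB : LeadingTermClauses W p Dh)
    {N : ℕ} [NeZero N] (D : ModularParametrizationData W N) (hc : ¬ (p : ℤ) ∣ D.maninConstant)
    (hper : ∃ u : ℚ, ‖(u : ℚ_[p])‖ = 1 ∧ W.realPeriodRat = u * plusPeriod D.f)
    (hne : kuriharaPartial W p D.f 1 ≠ ⊤) :
    ∃ ℓ : ℕ, ℓ ∣ p ^ 2 ∧ (ReductionNonAnomalous W p → ℓ = 1) ∧
      ∃ m d : ℕ, kuriharaPartial W p D.f 1 = m ∧ kuriharaPartialInfty W p D.f = d ∧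
        (m : ℤ) - d + (padicRegulator Dh).valuation + padicValNat p W.tamagawaProduct + padicValNat p ℓ =
          1 + 2 * padicValNat p W.torsionOrder := by
  have hr1 : W.analyticRank ≤ 1 := by rw [hr]
  have hL : W.entireLFunction 1 = 0 := by
    by_contra hne'
    have h0 := (W.analyticRank_eq_zero_iff_holds (hmod W)).mpr hne'
    omega
  have hfin : Finite W.sha := (hGZK W hr1).2
  have hid := padicValNat_shaOrder_add_partialInfty_eq_of_kimRankOnePartialAt W p
    (kimRankOnePartialAt_of_kim2026_of_five_le W p hE73 hp5) hsurj htower hL hr hfin D hc hper hne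
  obtain ⟨-, ℓ, hℓ, hℓ1, hidK⟩ :=
    hX.schneider_and_padicVal_identity_rankOne_of_katoHalf_of_cert hKato hmodD hGZK hp5 he hsurj hr hcert hB
  exact ⟨ℓ, hℓ, hℓ1, kuriharaGap_identity_of_shaOrder_identities W p D.f hid hne hidK⟩

/-- **With Kim's Conjecture 1.10 at the pair** (`hT : ∂^{(∞)} = ord_p ∏c`), `p ≥ 5`: the prediction
**`∂^{(1)}(δ̃) + v(Reg_p(E,Dh)) + ord_p ℓ = 1`** (`p ∤ #E(ℚ)_tors` as `E[p]` is irreducible). Everything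
except Conj. 1.10 and the certificates is published: a measured violation REFUTES Conj. 1.10 at the pair.
Per pair; nothing booked. [cite: Kim2022StructureSelmer, Thm. 1.9 (6), Conj. 1.10 (PDF p. 8)]
[cite: Kato2004Asterisque, Thm. 17.4 (3) (p. 273)] [cite: Delbourgo2002, Theorem (B) (p. 40)] -/
theorem ClassX4Gord.kuriharaPartial_one_identity_rankOne_of_kim2026_of_tamagawaDefect_of_katoHalf_of_cert_of_five_le
    (hE73 : Kim2026.kuriharaPartial_vanishingOrder_eq_padicValNat_sha_add_partialInfty_of_maninConstant)
    (hKato : Wuthrich2014.kato_halfEigenCharIdeal_dvd_cyclotomicPrime_of_surjective)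
    (hmodD : nonempty_modularParametrizationData)
    (hGZK : rank_eq_analyticRank_of_analyticRank_le_one) (hmod : hasEntireLFunction_rat)
    (hX : ClassX4Gord W p) (hp5 : 5 ≤ p) (he : semistabilityIndex W p = 2) (hsurj : Surj W p)
    (htower : ∀ n : ℕ, W.HasSurjectiveModNGaloisRep (p ^ n : ℕ))
    (hr : W.analyticRank = 1) (hcert : BranchUnitCertificateAt W p)
    {Dh : PAdicHeightData W p} (hB : LeadingTermClauses W p Dh)
    {N : ℕ} [NeZero N] (D : ModularParametrizationData W N) (hc : ¬ (p : ℤ) ∣ D.maninConstant)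
    (hper : ∃ u : ℚ, ‖(u : ℚ_[p])‖ = 1 ∧ W.realPeriodRat = u * plusPeriod D.f)
    (hne : kuriharaPartial W p D.f 1 ≠ ⊤) (hT : X4.KimTamagawaDefectAt W p D.f) :
    ∃ ℓ : ℕ, ℓ ∣ p ^ 2 ∧ (ReductionNonAnomalous W p → ℓ = 1) ∧
      ∃ m : ℕ, kuriharaPartial W p D.f 1 = m ∧
        (m : ℤ) + (padicRegulator Dh).valuation + padicValNat p ℓ = 1 := by
  obtain ⟨ℓ, hℓ, hℓ1, m, d, hm, hd, hid⟩ :=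
    hX.kuriharaGap_identity_rankOne_of_kim2026_of_katoHalf_of_cert_of_five_le hE73 hKato hmodD hGZK hmod
      hp5 he hsurj htower hr hcert hB D hc hper hne
  have htors0 : padicValNat p W.torsionOrder = 0 :=
    padicValNat_torsionOrder_eq_zero_of_irreducible W p hX.1.2.2
  unfold X4.KimTamagawaDefectAt at hT
  have hdT : (d : ℕ∞) = (padicValNat p W.tamagawaProduct : ℕ∞) := hd.symm.trans hT
  have hdT' : d = padicValNat p W.tamagawaProduct := by exact_mod_cast hdT
  refine ⟨ℓ, hℓ, hℓ1, m, hm, ?_⟩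
  rw [htors0, hdT'] at hid
  simp only [Nat.cast_zero, mul_zero, add_zero] at hid
  linarith

end FiveLe

/-! ## §2 `p = 3`: the `∂`-gap by the Kato/Delbourgo side, modulo our `∂`-clause conjecture (no Conj. 1.10) -/

section Three

variable {W : WeierstrassCurve ℚ} [W.IsElliptic] [W.IsGloballyMinimal] [hp : Fact (Nat.Prime 3)]

/-- **X4♯(G-ord)@3 ∩ `I₀*`, surj(3), `r_an = 1`, branch-unit certificate, (B)-datum, cyclotomic dual
datum, ONE non-zero prime-level Kurihara number: `∂^{(1)}(δ̃) − ∂^{(∞)}(δ̃) + v(Reg₃(E,Dh)) + ord₃ ∏c +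
ord₃ ℓ = 1 + 2·ord₃ #E(ℚ)_tors`** — modulo OUR conjecture `X4SharpThreeKimRankOnePartial` (in place of
`hE73`) + Kato 17.4 (3) + GZK + modularity + the certificates; NO Conjecture 1.10 (FILE 6 gave the
Conj.-1.10 form). Tower = p14's theorem (no certificate). Per pair; nothing booked.
[cite: Kim2022StructureSelmer, Thm. 1.9 (6) (PDF p. 8)] [cite: Kato2004Asterisque, Thm. 17.4 (3) (p. 273)]
[cite: Delbourgo2002, Theorem (B) (p. 40)] -/
theorem ClassX4Gord.kuriharaGap_identity_three_rankOne_of_kimPartial_of_katoHalf_of_cert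
    (h3 : X4SharpThreeKimRankOnePartial)
    (hKato : Wuthrich2014.kato_halfEigenCharIdeal_dvd_cyclotomicPrime_of_surjective)
    (hmodD : nonempty_modularParametrizationData)
    (hGZK : rank_eq_analyticRank_of_analyticRank_le_one) (hmod : hasEntireLFunction_rat)
    (hX : ClassX4Gord W 3) (he : semistabilityIndex W 3 = 2) (hsurj : Surj W 3)
    (hcert : BranchUnitCertificateAt W 3) (hr : W.analyticRank = 1)
    {Dh : PAdicHeightData W 3} (hB : LeadingTermClauses W 3 Dh)
    {κ : ZpExtension ℚ 3} {γ : Field.absoluteGaloisGroup ℚ}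
    (hκ : κ.IsCyclotomic) (hγ : κ.IsTopGenerator γ) (hγ' : IsCyclotomicVariable 3 γ)
    (Dsel : W.SelmerDualData κ γ) {fE : IwasawaAlgebra 3} (hchar : Dsel.charIdeal = Ideal.span {fE})
    {N : ℕ} [NeZero N] (D : ModularParametrizationData W N) (hc : ¬ (3 : ℤ) ∣ D.maninConstant)
    (hper : ∃ u : ℚ, ‖(u : ℚ_[3])‖ = 1 ∧ W.realPeriodRat = u * plusPeriod D.f)
    (hne : kuriharaPartial W 3 D.f 1 ≠ ⊤) :
    ∃ ℓ : ℕ, ℓ ∣ 3 ^ 2 ∧ (ReductionNonAnomalous W 3 → ℓ = 1) ∧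
      ∃ m d : ℕ, kuriharaPartial W 3 D.f 1 = m ∧ kuriharaPartialInfty W 3 D.f = d ∧
        (m : ℤ) - d + (padicRegulator Dh).valuation + padicValNat 3 W.tamagawaProduct + padicValNat 3 ℓ =
          1 + 2 * padicValNat 3 W.torsionOrder := by
  have hr1 : W.analyticRank ≤ 1 := by rw [hr]
  have hL : W.entireLFunction 1 = 0 := by
    by_contra hne'
    have h0 := (W.analyticRank_eq_zero_iff_holds (hmod W)).mpr hne'
    omega
  have hfin : Finite W.sha := (hGZK W hr1).2
  haveI : Finite W.sha := hfin
  have hid := padicValNat_shaOrder_add_partialInfty_eq_of_kimRankOnePartialAt W 3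
    (kimRankOnePartialAt_three_of_classX4 W h3 hX.1) hsurj
    (ClassX4.towerSurj_three_of_surj_of_typeG_or_potMult hX.1 (Or.inl hX.typeGOrd.typeG) hsurj) hL hr hfin
    D (by exact_mod_cast hc) hper hne
  obtain ⟨-, -, -, -, ℓ, hℓ, hℓ1, hidK⟩ :=
    hX.padicVal_identity_three_rankOne_of_katoHalf_of_cert hKato hmodD hGZK he hsurj hcert hr hB hκ hγ hγ'
      Dsel hchar
  rw [padicValNat_card_addPrimaryComponent 3] at hidK
  have hidK' : (padicValNat 3 W.shaOrder : ℤ) + (padicRegulator Dh).valuation +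
      padicValNat 3 W.tamagawaProduct + padicValNat 3 ℓ = 1 + 2 * padicValNat 3 W.torsionOrder := by
    unfold WeierstrassCurve.shaOrder; exact hidK
  exact ⟨ℓ, hℓ, hℓ1, kuriharaGap_identity_of_shaOrder_identities W 3 D.f hid hne hidK'⟩

end Three

end Summit.BirchSwinnertonDyer.Rank1Residual.Additive

end
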